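import Summits.KontsevichZagierPeriods.KontsevichZagierPeriods.Theorems.LinRedNormalFormHoffmanIndependenceRealSpanning
import Summits.KontsevichZagierPeriods.KontsevichZagierPeriods.Theorems.LinRedNormalFormHoffmanSpanInKZLeTen
import Summits.KontsevichZagierPeriods.KontsevichZagierPeriods.Theorems.LinRedNormalFormHoffmanSpanInKZEds11

/-!
# Crux `LinRedNormalForm.HoffmanIndependence` (stmt-KontsevichZagierPeriods-15045), line `weight_split`,
# cycle 4: Brown's theorem and the dimension bound through weight `11`, UNCONDITIONALLY

The real spanning bridge (`…HoffmanIndependenceRealSpanning`: `SpanAt N → hoffmanSpan N = mzvSpace N`,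
soundness of the KZ calculus + Kontsevich's formula) applied to the landed, kernel-checked
extended-double-shuffle certificates of the sister crux `HoffmanSpanInKZ` (line 15044/`Sketch`:
`spanAt_of_le_ten` from the tables `stub_eds7 … stub_eds10`, and `stub_eds11`):

* `hoffmanSpan_eq_mzvSpace_of_le_eleven`: **Brown's theorem (Hoffman's Conjecture 2) holds for real
  MZVs in every weight `n ≤ 11`** — every `ζ(s)` of weight `≤ 11` is a rational combination of the
  Hoffman values `ζ(u)`, `u ∈ {2,3}^×`, of the same weight (the tree had `n ≤ 9`,
  `hoffmanSpan_eq_mzvSpace_of_le_nine`, by hand-made relation files);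
* `finrank_mzvSpace_le_zagierDim_of_le_eleven`: **the Terasoma–Deligne–Goncharov bound
  `dim_ℚ 𝒵_n ≤ d_n` for `n ≤ 11`**, in particular `dim_ℚ 𝒵₁₀ ≤ 7` and `dim_ℚ 𝒵₁₁ ≤ 9`
  (`finrank_mzvSpace_ten_le`, `finrank_mzvSpace_eleven_le`); products of Hoffman spans of total
  weight `≤ 11` stay in the Hoffman span (`mul_mem_hoffmanSpan_of_le_eleven`);
* for this crux: `inWeight_iff_finrank_mzvSpace_eq_of_le_eleven` — the slices `n ≤ 11` of the
  registered stub `stub_inWeight` are EXACTLY Zagier's dimension statements `dim_ℚ 𝒵_n = d_n`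
  (no Brown), and `finrank_mzvSpace_eq_of_hoffmanIndependence_of_le_eleven` — the crux proves
  Zagier's dimension table `1, 0, 1, 1, 1, 2, 2, 3, 4, 5, 7, 9` through weight `11` outright
  (Zagier's 1994 numerical range was `≤ 12`; weight `12` follows the same way from `EdsCertificate 12`,
  `finrank_mzvSpace_eq_of_hoffmanIndependence_of_edsCertificate`).

No motivic input anywhere: the certificates are elimination transcripts over finite double shuffle +
Hoffman's relation + duality, realised as KZ move chains, and evaluated by `KZ.eval`.

Sources: F. Brown, Ann. of Math. 175 (2012), Thm 1.1; T. Terasoma, Invent. Math. 149 (2002), Thm 1.2;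
D. Zagier, ECM 1992 (1994), §9; K. Ihara, M. Kaneko, D. Zagier, Compos. Math. 142 (2006), §1;
M. Kaneko, M. Noro, K. Tsurumaki, IMA Vol. 148 (2008); M. Kontsevich, D. Zagier, *Periods* (2001), §1.
-/

noncomputable section

namespace Summit.KontsevichZagierPeriods.LinRedNormalForm.HoffmanIndependence

open Literature.NumberTheory.Transcendental MZV
open Summit.KontsevichZagierPeriods.MzvKernelInKZ.TwoPosets (EdsCertificate)
open Summit.KontsevichZagierPeriods.LinRedNormalForm.HoffmanSpanInKZ
  (SpanAt spanAt_of_le_ten spanAt_of_edsCertificate stub_eds11)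
open Summit.KontsevichZagierPeriods.KontsevichZagierPeriods.Theses.LinRedNormalForm (HoffmanIndependence)

/-! ## The slices of crux #6 through weight `11` -/

/-- The weight slices `SpanAt n` of crux `HoffmanSpanInKZ` hold for every `n ≤ 11` (landed
certificates: `spanAt_of_le_ten`, and `stub_eds11` through `spanAt_of_edsCertificate`).
[cite: IharaKanekoZagier2006, §1] -/
theorem spanAt_of_le_eleven {n : ℕ} (hn : n ≤ 11) : SpanAt n := by
  rcases Nat.lt_or_ge n 11 with h | h
  · exact spanAt_of_le_ten (by omega)
  · obtain rfl : n = 11 := le_antisymm hn h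
    exact spanAt_of_edsCertificate stub_eds11

/-! ## Brown's theorem and the dimension bound through weight `11` -/

/-- **Brown's theorem in weights `≤ 11`, unconditionally**: `hoffmanSpan n = mzvSpace n` for
`n = 0, …, 11` — every real MZV of weight `≤ 11` is a rational combination of Hoffman values of the
same weight. [cite: Brown2012, Theorem 1.1] -/
theorem hoffmanSpan_eq_mzvSpace_of_le_eleven {n : ℕ} (hn : n ≤ 11) : hoffmanSpan n = mzvSpace n :=
  hoffmanSpan_eq_mzvSpace_of_spanAt (spanAt_of_le_eleven hn)

/-- Every real MZV of weight `n ≤ 11` lies in the Hoffman span of weight `n`.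
[cite: Brown2012, Theorem 1.1] -/
theorem multipleZeta_mem_hoffmanSpan_of_weight_le_eleven {s : List ℕ} (hs : IsAdmissible s)
    (hw : weight s ≤ 11) : multipleZeta s ∈ hoffmanSpan (weight s) :=
  multipleZeta_mem_hoffmanSpan_of_spanAt (spanAt_of_le_eleven hw) hs rfl

/-- **The Terasoma–Deligne–Goncharov bound in weights `≤ 11`, unconditionally**:
`dim_ℚ 𝒵_n ≤ d_n` for `n ≤ 11` (`d₀, …, d₁₁ = 1, 0, 1, 1, 1, 2, 2, 3, 4, 5, 7, 9`).
[cite: Terasoma2002, Theorem 1.2] -/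
theorem finrank_mzvSpace_le_zagierDim_of_le_eleven {n : ℕ} (hn : n ≤ 11) :
    Module.finrank ℚ (mzvSpace n) ≤ zagierDim n :=
  finrank_mzvSpace_le_zagierDim_of_spanAt (spanAt_of_le_eleven hn)

/-- `dim_ℚ 𝒵₁₀ ≤ 7`: the `ℚ`-span of the `256` convergent MZVs of weight `10` has dimension at most
`7`, unconditionally. [cite: Terasoma2002, Theorem 1.2] [cite: Zagier1994, §9] -/
theorem finrank_mzvSpace_ten_le : Module.finrank ℚ (mzvSpace 10) ≤ 7 :=
  finrank_mzvSpace_le_zagierDim_of_le_eleven (by norm_num)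

/-- `dim_ℚ 𝒵₁₁ ≤ 9`: the `ℚ`-span of the `512` convergent MZVs of weight `11` has dimension at most
`9`, unconditionally. [cite: Terasoma2002, Theorem 1.2] [cite: Zagier1994, §9] -/
theorem finrank_mzvSpace_eleven_le : Module.finrank ℚ (mzvSpace 11) ≤ 9 :=
  finrank_mzvSpace_le_zagierDim_of_le_eleven le_rfl

/-- Unconditionally in total weight `≤ 11`: `hoffmanSpan a · hoffmanSpan b ⊆ hoffmanSpan (a + b)`
(the stuffle product `mem_mzvSpace_mul_holds` and Brown's theorem in weight `a + b`).
[cite: Brown2012, Theorem 1.1] [cite: Hoffman1997] -/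
theorem mul_mem_hoffmanSpan_of_le_eleven {a b : ℕ} (hab : a + b ≤ 11) {x y : ℝ}
    (hx : x ∈ hoffmanSpan a) (hy : y ∈ hoffmanSpan b) : x * y ∈ hoffmanSpan (a + b) := by
  rw [hoffmanSpan_eq_mzvSpace_of_le_eleven hab]
  exact mem_mzvSpace_mul_holds (hoffmanSpan_le_mzvSpace a hx) (hoffmanSpan_le_mzvSpace b hy)

/-! ## Consequences for the crux -/

/-- **Slices `n ≤ 11` of `stub_inWeight` are exactly Zagier's dimension conjecture in weight `n`**,
with no motivic input: the `d_n` real Hoffman values of weight `n ≤ 11` are `ℚ`-linearly independent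
iff `dim_ℚ 𝒵_n = d_n`. Slices `n ≤ 4` hold (`inWeight_of_le_four`); slices `5, …, 11` are the open
statements `dim_ℚ 𝒵_n = 2, 2, 3, 4, 5, 7, 9`. [cite: Zagier1994, §9] -/
theorem inWeight_iff_finrank_mzvSpace_eq_of_le_eleven {n : ℕ} (hn : n ≤ 11) :
    LinearIndependent ℚ
        (fun u : {u : List ℕ // IsHoffman u ∧ weight u = n} => multipleZeta u.1) ↔
      Module.finrank ℚ (mzvSpace n) = zagierDim n :=
  inWeight_iff_finrank_mzvSpace_eq_of_spanAt (spanAt_of_le_eleven hn)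

/-- **The crux proves Zagier's dimension table through weight `11` outright**:
`HoffmanIndependence → dim_ℚ 𝒵_n = d_n` for every `n ≤ 11` (lower bound from the crux, upper bound
from the certificates; no Brown, no Terasoma). [cite: Zagier1994, §9] -/
theorem finrank_mzvSpace_eq_of_hoffmanIndependence_of_le_eleven : HoffmanIndependence → ∀ {n : ℕ}, n ≤ 11 → Module.finrank ℚ (mzvSpace n) = zagierDim n :=
  fun h _ hn => finrank_mzvSpace_eq_of_hoffmanIndependence_of_spanAt h (spanAt_of_le_eleven hn)

/-- Weight `12` (and any further weight) the same way, from an EDS certificate in that weight: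
`HoffmanIndependence → EdsCertificate n → dim_ℚ 𝒵_n = d_n`. [cite: Zagier1994, §9] [cite: IharaKanekoZagier2006, §1] -/
theorem finrank_mzvSpace_eq_of_hoffmanIndependence_of_edsCertificate (h : HoffmanIndependence)
    {n : ℕ} (hE : EdsCertificate n) : Module.finrank ℚ (mzvSpace n) = zagierDim n :=
  finrank_mzvSpace_eq_of_hoffmanIndependence_of_spanAt h (spanAt_of_edsCertificate hE)

/-- The slice of `stub_inWeight` in any certified weight is Zagier's dimension statement there.
[cite: Zagier1994, §9] [cite: IharaKanekoZagier2006, §1] -/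
theorem inWeight_iff_finrank_mzvSpace_eq_of_edsCertificate {n : ℕ} (hE : EdsCertificate n) :
    LinearIndependent ℚ
        (fun u : {u : List ℕ // IsHoffman u ∧ weight u = n} => multipleZeta u.1) ↔
      Module.finrank ℚ (mzvSpace n) = zagierDim n :=
  inWeight_iff_finrank_mzvSpace_eq_of_spanAt (spanAt_of_edsCertificate hE)

end Summit.KontsevichZagierPeriods.LinRedNormalForm.HoffmanIndependence
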